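import Mathlib
import Literature.Computability.Complexity.RandomKSatEnsembleOGP
import Literature.Computability.Complexity.RandomKSatLowDegreeHardness
import Summits.PneNP.PneNP.Theorems.OverlapGapAlgebraNoStableSectionDefs
import Summits.PneNP.PneNP.Theorems.OverlapGapAlgebraSearchHardWindowChainMassBasic
import Summits.PneNP.PneNP.Theorems.OverlapGapAlgebraSearchHardWindowChainMassUnion
import Summits.PneNP.PneNP.Theorems.OverlapGapAlgebraSearchHardWindowChaosAssembly
import Summits.PneNP.PneNP.Theorems.OverlapGapAlgebraSearchHardWindowMultiTimeMarginal
import Summits.PneNP.PneNP.Theorems.OverlapGapAlgebraSearchHardWindowSlotFactorization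
import Summits.PneNP.PneNP.Theorems.OverlapGapAlgebraSearchHardWindowBlockExpansion
import Summits.PneNP.PneNP.Theorems.OverlapGapAlgebraSearchHardWindowSlotBound
import Summits.PneNP.PneNP.Theorems.OverlapGapAlgebraSearchHardWindowBandEnergy
import Summits.PneNP.PneNP.Theorems.OverlapGapAlgebraSearchHardWindowBandCount
import Summits.PneNP.PneNP.Theorems.OverlapGapAlgebraSearchHardWindowOgpCore
import Summits.PneNP.PneNP.Theorems.OverlapGapAlgebraSearchHardWindowOgpAsymptotics
import Summits.PneNP.PneNP.Theorems.OverlapGapAlgebraSearchHardWindowStrongLDH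

/-!
# Route OverlapGapAlgebra, crux `SearchHardWindow` (stmt-PneNP-2460), line `Sketch`: the ensemble OGP
# of random `k`-SAT on the resampling chain (Huang–Sellke 2025, Lemma 3.22) — PROVED, and the
# unconditional strong low-degree hardness (Huang–Sellke 2025, Cor. 3.21)

This file closes the cone of the named facts of line `Sketch` (skeleton
`Summits/PneNP/PneNP/Cruxes/SearchHardWindow/Lines/Sketch.lean`, section `EnsembleOGP`, lead c2):

* `ogp_tupleBound` — the first moment for ONE time tuple and ONE banded assignment tuple (the lead's
  composition of the landed stubs `stub_multiTimeMarginal` (finite-dimensional marginal of the chain),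
  `stub_slotFactorization` (product over clause slots), `stub_blockExpansion` (mixture over refresh
  patterns = admissible block-root maps), `stub_slotBound` (the literal-level greedy bound) and
  `stub_bandEnergy` (band ⇒ first-appearance energy with `s` darts, DartGame `en_rung`)):
  survival `≤ base^m`;
* `huangSellke2025KSatEnsembleOGP_holds : HuangSellke2025KSatEnsembleOGP` — **Huang–Sellke 2025,
  Lemma 3.22** (arXiv:2501.06427 §3.3.2; "adaptation of Bresler–Huang 2021 Prop. 4.7(iii)"), from
  `ogp_tupleBound`, `stub_bandCount`, `stub_ogpCore` (first moment at one `n`) and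
  `stub_ogpAsymptotics` (parameters `β = 2.65 log k/k`, `η = 0.05 log k/k`, …);
* the corollaries, now UNCONDITIONAL: `huangSellke2025KSatObstructions_holds` (Lemmas 3.22–3.23),
  `huangSellke2025KSat_holds` (**Cor. 3.21, strong low-degree hardness of random `k`-SAT at
  `α_k = 5·2^k log k/k`**), `acZeroRung_holds`, `decisionTreeRung_holds` (the `AC⁰` and bounded-query
  rungs of Line A), by the landed reductions of `…StrongLDH.lean`.

Mathematical note (why the literal-level argument): the printed proof of Lemma 3.22 reduces to
coincident times ("the contribution of any `(t₀,…,t_k)` is upper bounded by the case `t₀ = ⋯ = t_k`");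
for the LITERAL-level resampling chain this is false pointwise (a partially refreshed clause can make
the union of the replicas' violation events smaller — anti-correlated pairs, clumped compatible
replicas), while Bresler–Huang's own path interrupts `≤ k+1` clause slots. The proof here fixes the
refresh pattern, disjointifies by the first violated replica, certifies a violation as first against
RECENT earlier replicas (sharing `≥ k − F + 1` positions) by pattern newness on `s = k − F` shared darts
and against the other `≤ ℓ` replicas by their `≥ F` fresh literals (`stub_slotBound`); the certified
energy `1 + k(1 − SB_s) − θk(k+1)/2 − k(k+1)2^{−F}/2 ≥ 0.55 k` still beats the count exponent at `κ = 5`.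

References: B. Huang, M. Sellke, arXiv:2501.06427 (2025), §3.3.2, Lemma 3.22, Cor. 3.21
[HuangSellke2025]; G. Bresler, B. Huang, FOCS 2021 / arXiv:2106.02129, Prop. 4.7, §5 [BreslerHuang2022].
-/

set_option linter.dupNamespace false -- `Summit.PneNP.PneNP.…`: summit = sub-problem

noncomputable section

namespace Summit.PneNP.PneNP.Theorems

open Finset Filter Asymptotics
open Literature.Computability.Complexity
open Literature.Computability.Complexity.LowDegree
open Summit.PneNP.PneNP.Cruxes.NoStableSection.DartGame (seqOf)
open scoped Classical

/-! ## The first moment for one time tuple and one banded tuple -/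

/-- A first-appearance count with `s` darts is at most `n^s`. -/
theorem ogp_faCard_le (n k s : ℕ) (Y : Fin (k + 1) → Fin n → Bool) (ℓ : Fin (k + 1)) :
    ((univ.filter fun I : Fin s → Fin n =>
        ∀ ℓ' : Fin (k + 1), ℓ' < ℓ → ¬ ∀ r, Y ℓ (I r) = Y ℓ' (I r)).card : ℝ) ≤ (n : ℝ) ^ s := by
  have h := Finset.card_filter_le (univ : Finset (Fin s → Fin n))
    (fun I => ∀ ℓ' : Fin (k + 1), ℓ' < ℓ → ¬ ∀ r, Y ℓ (I r) = Y ℓ' (I r))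
  rw [Finset.card_univ, Fintype.card_fun, Fintype.card_fin, Fintype.card_fin] at h
  exact_mod_cast h

/-- `#(Fin m × Fin k → Γ) = #(Fin k → Γ)^m`. -/
theorem ogp_card_inst (m k : ℕ) (Γ : Type) [Fintype Γ] :
    (Fintype.card (Fin m × Fin k → Γ) : ℝ) = (Fintype.card (Fin k → Γ) : ℝ) ^ m := by
  norm_cast
  rw [Fintype.card_fun, Fintype.card_fun, Fintype.card_prod, Fintype.card_fin, Fintype.card_fin,
    ← pow_mul, mul_comm]

/-- **T — the first moment for ONE time tuple and ONE banded tuple** (composition of stubs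
M, F, R, G, E): for times `τ 0 ≤ ⋯ ≤ τ k ≤ K` and assignments `Y 0, …, Y k` in the LOWER band
(`H(Y ℓ | earlier) ≥ b ≥ 2θ`), the paths on which every `Y ℓ` satisfies the instance at time `τ ℓ`
have mass `≤ base^m`,
`base = 1 − 2^{−k}(1 + k(1 − SB_s(p₀)) − θk(k+1)/2 − k(k+1)/2 · 2^{−F})`. -/
theorem ogp_tupleBound (n m k s F : ℕ) (hn : 1 ≤ n) (hsF : s + F ≤ k) (θ b : ℝ) (hθ : 0 < θ)
    (hθ1 : θ < 1) (hb : 2 * θ ≤ b) (ε : ℝ) (hε0 : 0 ≤ ε) (hε1 : ε ≤ 1) (K : ℕ)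
    (τ : Fin (k + 1) → ℕ) (hτ : Monotone τ) (hτK : τ (Fin.last k) ≤ K)
    (Y : Fin (k + 1) → Fin n → Bool)
    (hband : ∀ ℓ : ℕ, 1 ≤ ℓ → ℓ ≤ k → b ≤ overlapCondEnt (seqOf Y) ℓ) :
    resampleChainMass ε K (fun z : ℕ → (Fin m × Fin k → Fin n × Bool) =>
        ∀ i : Fin m, ∀ ℓ : Fin (k + 1), ∃ j : Fin k, Y ℓ (z (τ ℓ) (i, j)).1 = (z (τ ℓ) (i, j)).2) ≤
      (1 - (1 / 2 : ℝ) ^ k * (((1 : ℝ) + k * (1 - (2 * (1 - (b - 2 * θ) / (-Real.log θ)) ^ s + s * ((b - 2 * θ) / (-Real.log θ)) * (1 - (b - 2 * θ) / (-Real.log θ)) ^ (s - 1))) - θ * ((k : ℝ) * (k + 1) / 2)) - (k : ℝ) * (k + 1) / 2 * (1 / 2 : ℝ) ^ F)) ^ m := by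
  haveI hne : Nonempty (Fin n × Bool) := ⟨(⟨0, hn⟩, true)⟩
  have hnr : (0 : ℝ) < n := by exact_mod_cast hn
  have hns : (0 : ℝ) < (n : ℝ) ^ s := pow_pos hnr s
  have hcpos : 0 < (Fintype.card (Fin k → Fin n × Bool) : ℝ) := by exact_mod_cast Fintype.card_pos
  -- Step E: the band gives energy, so `base' ≤ base`, and `0 ≤ base'`
  have hE := stub_bandEnergy n k s hn Y θ b hθ hθ1 hb hband
  have hpen0 : 0 ≤ (k : ℝ) * (k + 1) / 2 * (1 / 2 : ℝ) ^ F := by positivity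
  have hhalf : (0 : ℝ) ≤ (1 / 2 : ℝ) ^ k := by positivity
  have hFAle : (∑ ℓ : Fin (k + 1), ((univ.filter fun I : Fin s → Fin n =>
              ∀ ℓ' : Fin (k + 1), ℓ' < ℓ → ¬ ∀ r, Y ℓ (I r) = Y ℓ' (I r)).card : ℝ)) ≤ ((k : ℝ) + 1) * (n : ℝ) ^ s := by
    have h := Finset.sum_le_sum (s := (univ : Finset (Fin (k + 1))))
      (fun ℓ _ => ogp_faCard_le n k s Y ℓ)
    simp only [Finset.sum_const, Finset.card_univ, Fintype.card_fin, nsmul_eq_mul] at h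
    push_cast at h
    exact h
  have hFAdiv : (∑ ℓ : Fin (k + 1), ((univ.filter fun I : Fin s → Fin n =>
              ∀ ℓ' : Fin (k + 1), ℓ' < ℓ → ¬ ∀ r, Y ℓ (I r) = Y ℓ' (I r)).card : ℝ)) / (n : ℝ) ^ s ≤ (k : ℝ) + 1 := by
    rw [div_le_iff₀ hns]; exact hFAle
  have hEdiv : ((1 : ℝ) + k * (1 - (2 * (1 - (b - 2 * θ) / (-Real.log θ)) ^ s + s * ((b - 2 * θ) / (-Real.log θ)) * (1 - (b - 2 * θ) / (-Real.log θ)) ^ (s - 1))) - θ * ((k : ℝ) * (k + 1) / 2)) ≤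
      (∑ ℓ : Fin (k + 1), ((univ.filter fun I : Fin s → Fin n =>
              ∀ ℓ' : Fin (k + 1), ℓ' < ℓ → ¬ ∀ r, Y ℓ (I r) = Y ℓ' (I r)).card : ℝ)) / (n : ℝ) ^ s := by
    rw [le_div_iff₀ hns]; linarith
  have hbase'0 : 0 ≤ (1 - (1 / 2 : ℝ) ^ k * ((∑ ℓ : Fin (k + 1), ((univ.filter fun I : Fin s → Fin n =>
              ∀ ℓ' : Fin (k + 1), ℓ' < ℓ → ¬ ∀ r, Y ℓ (I r) = Y ℓ' (I r)).card : ℝ)) / (n : ℝ) ^ s - (k : ℝ) * (k + 1) / 2 * (1 / 2 : ℝ) ^ F)) := by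
    have h2 : ((k : ℝ) + 1) * (1 / 2 : ℝ) ^ k ≤ 1 := by
      have hk2 : ((k : ℝ) + 1) ≤ (2 : ℝ) ^ k := by
        have : k < 2 ^ k := Nat.lt_two_pow_self
        exact_mod_cast this
      calc ((k : ℝ) + 1) * (1 / 2 : ℝ) ^ k ≤ (2 : ℝ) ^ k * (1 / 2 : ℝ) ^ k :=
            mul_le_mul_of_nonneg_right hk2 hhalf
        _ = 1 := by rw [← mul_pow]; norm_num
    have h3 : (1 / 2 : ℝ) ^ k * ((∑ ℓ : Fin (k + 1), ((univ.filter fun I : Fin s → Fin n =>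
              ∀ ℓ' : Fin (k + 1), ℓ' < ℓ → ¬ ∀ r, Y ℓ (I r) = Y ℓ' (I r)).card : ℝ)) / (n : ℝ) ^ s - (k : ℝ) * (k + 1) / 2 * (1 / 2 : ℝ) ^ F) ≤ (1 / 2 : ℝ) ^ k * ((k : ℝ) + 1) :=
      mul_le_mul_of_nonneg_left (by linarith) hhalf
    nlinarith
  have hbase'le : (1 - (1 / 2 : ℝ) ^ k * ((∑ ℓ : Fin (k + 1), ((univ.filter fun I : Fin s → Fin n =>
              ∀ ℓ' : Fin (k + 1), ℓ' < ℓ → ¬ ∀ r, Y ℓ (I r) = Y ℓ' (I r)).card : ℝ)) / (n : ℝ) ^ s - (k : ℝ) * (k + 1) / 2 * (1 / 2 : ℝ) ^ F)) ≤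
      (1 - (1 / 2 : ℝ) ^ k * (((1 : ℝ) + k * (1 - (2 * (1 - (b - 2 * θ) / (-Real.log θ)) ^ s + s * ((b - 2 * θ) / (-Real.log θ)) * (1 - (b - 2 * θ) / (-Real.log θ)) ^ (s - 1))) - θ * ((k : ℝ) * (k + 1) / 2)) - (k : ℝ) * (k + 1) / 2 * (1 / 2 : ℝ) ^ F)) := by
    have h1 : (1 / 2 : ℝ) ^ k * (((1 : ℝ) + k * (1 - (2 * (1 - (b - 2 * θ) / (-Real.log θ)) ^ s + s * ((b - 2 * θ) / (-Real.log θ)) * (1 - (b - 2 * θ) / (-Real.log θ)) ^ (s - 1))) - θ * ((k : ℝ) * (k + 1) / 2)) - (k : ℝ) * (k + 1) / 2 * (1 / 2 : ℝ) ^ F) ≤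
        (1 / 2 : ℝ) ^ k * ((∑ ℓ : Fin (k + 1), ((univ.filter fun I : Fin s → Fin n =>
              ∀ ℓ' : Fin (k + 1), ℓ' < ℓ → ¬ ∀ r, Y ℓ (I r) = Y ℓ' (I r)).card : ℝ)) / (n : ℝ) ^ s - (k : ℝ) * (k + 1) / 2 * (1 / 2 : ℝ) ^ F) :=
      mul_le_mul_of_nonneg_left (by linarith) hhalf
    linarith
  -- Step M: the finite-dimensional marginal at the times `τ`
  have hM := stub_multiTimeMarginal (ι := Fin m × Fin k) (Γ := Fin n × Bool) ε hε0 hε1 K k τ hτ hτK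
    (fun x => ∀ i : Fin m, ∀ ℓ : Fin (k + 1), ∃ j : Fin k, Y ℓ (x ℓ (i, j)).1 = (x ℓ (i, j)).2)
  refine hM.trans ?_
  -- the rates `δ ℓ = 1 − (1−ε)^{τ(ℓ+1) − τ ℓ}` lie in `[0, 1]`
  have hδ0 : ∀ ℓ : Fin k, 0 ≤ 1 - (1 - ε) ^ (τ ℓ.succ - τ ℓ.castSucc) := fun ℓ =>
    sub_nonneg.2 (pow_le_one₀ (sub_nonneg.2 hε1) (by linarith))
  have hδ1 : ∀ ℓ : Fin k, 1 - (1 - ε) ^ (τ ℓ.succ - τ ℓ.castSucc) ≤ 1 := fun ℓ =>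
    sub_le_self _ (pow_nonneg (sub_nonneg.2 hε1) _)
  -- Step F: factorise over the `m` clause slots
  have hF := stub_slotFactorization (A := Fin m) (B := Fin k) (Γ := Fin n × Bool) k
    (fun ℓ => 1 - (1 - ε) ^ (τ ℓ.succ - τ ℓ.castSucc))
    (fun (_ : Fin m) w => ∀ ℓ : Fin (k + 1), ∃ j : Fin k, Y ℓ (w ℓ j).1 = (w ℓ j).2)
  -- Steps R + G: every slot factor is `≤ base' · #(Fin k → Γ)`
  have hslot : (∑ w : Fin (k + 1) → Fin k → Fin n × Bool,
      (∏ ℓ : Fin k, resampleKernel (1 - (1 - ε) ^ (τ ℓ.succ - τ ℓ.castSucc))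
          (w ℓ.castSucc) (w ℓ.succ)) *
        @ite ℝ (∀ ℓ : Fin (k + 1), ∃ j : Fin k, Y ℓ (w ℓ j).1 = (w ℓ j).2)
          (Classical.propDecidable _) 1 0) ≤
      (1 - (1 / 2 : ℝ) ^ k * ((∑ ℓ : Fin (k + 1), ((univ.filter fun I : Fin s → Fin n =>
              ∀ ℓ' : Fin (k + 1), ℓ' < ℓ → ¬ ∀ r, Y ℓ (I r) = Y ℓ' (I r)).card : ℝ)) / (n : ℝ) ^ s - (k : ℝ) * (k + 1) / 2 * (1 / 2 : ℝ) ^ F)) *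
        (Fintype.card (Fin k → Fin n × Bool) : ℝ) := by
    refine stub_blockExpansion (B := Fin k) (Γ := Fin n × Bool) k
      (fun ℓ => 1 - (1 - ε) ^ (τ ℓ.succ - τ ℓ.castSucc)) hδ0 hδ1
      (fun w => @ite ℝ (∀ ℓ : Fin (k + 1), ∃ j : Fin k, Y ℓ (w ℓ j).1 = (w ℓ j).2)
          (Classical.propDecidable _) 1 0)
      (fun w => by positivity) _ (fun ρ hρ1 hρ2 => ?_)
    have hG := stub_slotBound n k s F hn hsF Y ρ hρ1 hρ2
    refine le_trans (le_of_eq ?_) hG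
    rw [Finset.natCast_card_filter]
    refine Finset.sum_congr rfl fun u _ => ?_
    simp only []
    congr 1
  -- nonnegativity of the slot factors
  have hslot0 : 0 ≤ (∑ w : Fin (k + 1) → Fin k → Fin n × Bool,
      (∏ ℓ : Fin k, resampleKernel (1 - (1 - ε) ^ (τ ℓ.succ - τ ℓ.castSucc))
          (w ℓ.castSucc) (w ℓ.succ)) *
        @ite ℝ (∀ ℓ : Fin (k + 1), ∃ j : Fin k, Y ℓ (w ℓ j).1 = (w ℓ j).2)
          (Classical.propDecidable _) 1 0) :=
    Finset.sum_nonneg fun w _ => mul_nonneg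
      (Finset.prod_nonneg fun ℓ _ => cmb_kernel_nonneg _ (hδ0 ℓ) (hδ1 ℓ) _ _) (by positivity)
  -- assemble: numerator = product of slot factors ≤ (base' c)^m, denominator = c^m
  have hnum : (∑ x : Fin (k + 1) → Fin m × Fin k → Fin n × Bool,
      (∏ ℓ : Fin k, resampleKernel (1 - (1 - ε) ^ (τ ℓ.succ - τ ℓ.castSucc))
          (x ℓ.castSucc) (x ℓ.succ)) *
        @ite ℝ (∀ i : Fin m, ∀ ℓ : Fin (k + 1), ∃ j : Fin k, Y ℓ (x ℓ (i, j)).1 = (x ℓ (i, j)).2)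
          (Classical.propDecidable _) 1 0) ≤
      ((1 - (1 / 2 : ℝ) ^ k * ((∑ ℓ : Fin (k + 1), ((univ.filter fun I : Fin s → Fin n =>
              ∀ ℓ' : Fin (k + 1), ℓ' < ℓ → ¬ ∀ r, Y ℓ (I r) = Y ℓ' (I r)).card : ℝ)) / (n : ℝ) ^ s - (k : ℝ) * (k + 1) / 2 * (1 / 2 : ℝ) ^ F)) *
        (Fintype.card (Fin k → Fin n × Bool) : ℝ)) ^ m := by
    calc (∑ x : Fin (k + 1) → Fin m × Fin k → Fin n × Bool,
      (∏ ℓ : Fin k, resampleKernel (1 - (1 - ε) ^ (τ ℓ.succ - τ ℓ.castSucc))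
          (x ℓ.castSucc) (x ℓ.succ)) *
        @ite ℝ (∀ i : Fin m, ∀ ℓ : Fin (k + 1), ∃ j : Fin k, Y ℓ (x ℓ (i, j)).1 = (x ℓ (i, j)).2)
          (Classical.propDecidable _) 1 0)
        = _ := Finset.sum_congr rfl fun x _ => by simp only []; congr 1; exact cmb_ite_congr Iff.rfl
      _ = _ := hF
      _ ≤ ∏ _a : Fin m, ((1 - (1 / 2 : ℝ) ^ k * ((∑ ℓ : Fin (k + 1), ((univ.filter fun I : Fin s → Fin n =>
              ∀ ℓ' : Fin (k + 1), ℓ' < ℓ → ¬ ∀ r, Y ℓ (I r) = Y ℓ' (I r)).card : ℝ)) / (n : ℝ) ^ s - (k : ℝ) * (k + 1) / 2 * (1 / 2 : ℝ) ^ F)) *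
        (Fintype.card (Fin k → Fin n × Bool) : ℝ)) :=
          Finset.prod_le_prod (fun _ _ => hslot0) (fun _ _ => hslot)
      _ = _ := by rw [Finset.prod_const, Finset.card_univ, Fintype.card_fin]
  have hden : (Fintype.card (Fin m × Fin k → Fin n × Bool) : ℝ) = (Fintype.card (Fin k → Fin n × Bool) : ℝ) ^ m :=
    ogp_card_inst m k (Fin n × Bool)
  rw [hden, div_le_iff₀ (pow_pos hcpos m)]
  calc _ ≤ _ := hnum
    _ = (1 - (1 / 2 : ℝ) ^ k * ((∑ ℓ : Fin (k + 1), ((univ.filter fun I : Fin s → Fin n =>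
              ∀ ℓ' : Fin (k + 1), ℓ' < ℓ → ¬ ∀ r, Y ℓ (I r) = Y ℓ' (I r)).card : ℝ)) / (n : ℝ) ^ s - (k : ℝ) * (k + 1) / 2 * (1 / 2 : ℝ) ^ F)) ^ m *
        (Fintype.card (Fin k → Fin n × Bool) : ℝ) ^ m := mul_pow _ _ _
    _ ≤ _ := mul_le_mul_of_nonneg_right (pow_le_pow_left₀ hbase'0 hbase'le m)
        (pow_nonneg hcpos.le m)

/-! ## Huang–Sellke 2025, Lemma 3.22, and the unconditional corollaries -/

/-- **Huang–Sellke 2025, Lemma 3.22 (ensemble OGP for random `k`-SAT on the `ε`-resampling chain)** —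
the Literature named fact `HuangSellke2025KSatEnsembleOGP` is a THEOREM: parameters and rate from `stub_ogpAsymptotics`;
eventually in `n` (`D n < n`, so `0 < ε ≤ 1`), the first moment `stub_ogpCore` (fed with
`stub_chainMassBasic`.1, `stub_chainMassUnion`, the per-tuple bound `ogp_tupleBound` and the count
`stub_bandCount`) is below the asymptotic bound. -/
theorem huangSellke2025KSatEnsembleOGP_holds : HuangSellke2025KSatEnsembleOGP := by
  unfold HuangSellke2025KSatEnsembleOGP
  obtain ⟨k₀, hk₀⟩ := stub_ogpAsymptotics
  refine ⟨max k₀ 1, fun k hk => ?_⟩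
  obtain ⟨β, η, θ, s, F, hη, hηβ, hβ5, hθ, hθ1, hb, hsF, hbase, hasy⟩ :=
    hk₀ k (le_trans (le_max_left _ _) hk)
  refine ⟨β, η, hη, hηβ, hβ5, fun D hD hD1 A => ?_⟩
  obtain ⟨c, hc, hev⟩ := hasy A
  refine ⟨c, hc, ?_⟩
  filter_upwards [hev, cas_eventually_lt D hD, eventually_ge_atTop 1] with n hevn hDn hn1
  intro m hm ε hε K hK
  obtain ⟨hεpos, hε1⟩ : 0 < ε ∧ ε ≤ 1 := by
    rw [hε]; exact cas_eps_bounds n (D n) hDn (hD1 n)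
  have hk1 : 1 ≤ k := le_trans (le_max_right _ _) hk
  have hβ0 : 0 ≤ β := by linarith
  subst hm
  have hcore := stub_ogpCore
    (fun ε h0 h1 K E E' hEE' =>
      (Summit.PneNP.PneNP.Theorems.stub_chainMassBasic ε h0 h1 K).1 E E' hEE')
    (fun ε h0 h1 K E => Summit.PneNP.PneNP.Theorems.stub_chainMassUnion ε h0 h1 K E)
    ogp_tupleBound stub_bandCount
    n ⌊5 * 2 ^ k * Real.log k / k * n⌋₊ k K s F hn1 hk1 hsF ε hεpos.le hε1 β η θ hβ0 hθ hθ1 hb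
    hbase
  exact hcore.trans (hevn K hK)

/-- **Huang–Sellke 2025, Lemmas 3.22–3.23 (the resampling-chain obstructions of random `k`-SAT)** —
the Literature named fact `HuangSellke2025KSatObstructions` is a THEOREM. -/
theorem huangSellke2025KSatObstructions_holds : HuangSellke2025KSatObstructions :=
  huangSellke2025KSatObstructions_of_ensembleOGP huangSellke2025KSatEnsembleOGP_holds

/-- **Huang–Sellke 2025, Corollary 3.21 (strong low-degree hardness of random `k`-SAT,
deterministic saturated form, `κ = 5`)** — the Literature named fact `HuangSellke2025KSat` is a
THEOREM: for `k ≥ k₀`, every sequence of coordinate-degree-`o(n)` maps of linear energy sign-solves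
`F_k(n, ⌊5·2^k log k/k · n⌋)` with probability `→ 0`. -/
theorem huangSellke2025KSat_holds : HuangSellke2025KSat :=
  huangSellke2025KSat_of_ensembleOGP huangSellke2025KSatEnsembleOGP_holds

/-- **The `AC⁰` rung of Line A, UNCONDITIONAL**: for `k ≥ k₀`, poly-size `AC⁰` solvers fail on
`F_k(2^j, ⌊α_k 2^j⌋)` (success `≤ ε` eventually, every `ε > 0`). -/
theorem acZeroRung_holds :
    ∃ k₀ : ℕ, ∀ k : ℕ, k₀ ≤ k → ∀ d c : ℕ, ∀ ε : ℝ, 0 < ε → ∀ᶠ n : ℕ in atTop, ∀ j m : ℕ,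
      n = 2 ^ j → m = ⌊5 * 2 ^ k * Real.log k / k * n⌋₊ →
      ∀ C : Fin (2 ^ j) → Circuit (Fin (m * k * (j + 1))),
        (∀ v, (C v).IsOver acBasis ∧ (C v).acDepth ≤ d ∧ (C v).size ≤ n ^ c) →
        ((univ.filter fun x : Fin (m * k * (j + 1)) → Bool => ∀ i : Fin m, ∃ j' : Fin k,
            (C (litArrayOfBits m k j x i j').1).eval x = (litArrayOfBits m k j x i j').2).card : ℝ)
          ≤ ε * 2 ^ (m * k * (j + 1)) :=
  acZeroRung_of_ensembleOGP huangSellke2025KSatEnsembleOGP_holds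

/-- **The decision-tree (bounded-query) rung of Line A, UNCONDITIONAL**: depth-`o(n)` decision trees
fail on `F_k(2^j, ⌊α_k 2^j⌋)` (success `≤ ε` eventually, every `ε > 0`). -/
theorem decisionTreeRung_holds :
    ∃ k₀ : ℕ, ∀ k : ℕ, k₀ ≤ k → ∀ t : ℕ → ℕ,
      (fun n : ℕ => (t n : ℝ)) =o[atTop] (fun n : ℕ => (n : ℝ)) → ∀ ε : ℝ, 0 < ε →
      ∀ᶠ n : ℕ in atTop, ∀ j m : ℕ, n = 2 ^ j → m = ⌊5 * 2 ^ k * Real.log k / k * n⌋₊ →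
      ∀ T : Fin (2 ^ j) → DecisionTree (m * k * (j + 1)), (∀ v, (T v).depth ≤ t n) →
        ((univ.filter fun x : Fin (m * k * (j + 1)) → Bool => ∀ i : Fin m, ∃ j' : Fin k,
            (T (litArrayOfBits m k j x i j').1).eval x = (litArrayOfBits m k j x i j').2).card : ℝ)
          ≤ ε * 2 ^ (m * k * (j + 1)) :=
  decisionTreeRung_of_ensembleOGP huangSellke2025KSatEnsembleOGP_holds

end Summit.PneNP.PneNP.Theorems

end
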